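import Summits.QuantumFields.YangMills.Theorems.LuscherReductionTwistedTraceScalingFPWeightEquivariance
import Summits.QuantumFields.YangMills.Theorems.LuscherReductionTwistedTraceScalingGaussianPi
import HarnessLib

/-!
# (N3) part 3 — the Gaussian determinant of the Laplace map is INVARIANT under global colour rotations: `normDet(A_{Ad p} ∘ e) = normDet(A_p ∘ e)`
# (lane A of S-BASE, crux `TwistedTraceScaling` stmt-QuantumFields-20203, C4 INNER; design note `pub/ym-fleet/ym-luscher-20007-p1/COARSE-DESIGN.md` §23.11 (N3))

With `A_p = laplaceMap p = P_Γ ∘ basedLin p ∘ flatLin` (`…FPWeightIntegrand`) and `e = euclToPiₗ` the Euclidean identification of the flat based coordinates (`…GaussianPi`), the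
Laplace value is `(πs²/a)^{3n/2}/normDet(A_p ∘ e)`.  THIS FILE: ★★ `normDet_laplaceMap_ad`: for `p` near `0` and every `g ∈ SU(2)`, `normDet(A_{Ad_g p} ∘ e) = normDet(A_p ∘ e)`.
Mechanism: `adFlatL g` (sitewise rotation of the flat coordinates) and the Euclidean isometry `adEucl g` it induces (`euclToPiₗ ∘ adEucl = adFlat ∘ euclToPiₗ`); `flatLin ∘ adFlat =
adSiteL ∘ flatLin`; `basedLin_ad` (p636701) and `starProjection_adL` (p629305) give ★ `laplaceMap_ad`: `A_{Ad p} (adFlat w) = adL g (A_p w)`; then `normDet` is unchanged by an isometry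
on either side (`normDet_comp_of_finrank_eq` + `LinearIsometry.normDet_eq_one` for the domain, `normDet_comp` + the isometric restriction of `adL g` for the codomain).
HONEST FRAMING: symmetry bookkeeping for a stub of a child of the CONDITIONAL reduction route R2b1; no spectral claim; C4 OPEN; not a gap, not Clay.
-/

set_option autoImplicit false

noncomputable section

open Filter Topology Real Module
open scoped BigOperators Matrix
open Literature.MathematicalPhysics.QuantumFieldTheory
open Literature.MathematicalPhysics.QuantumLattice

namespace Summit.QuantumFields.YangMills.Theorems.FemtoTransferGap.TwoLattice.ConstTube

open Summit.QuantumFields.YangMills.Theorems.FemtoTransferGap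
open Summit.QuantumFields.YangMills.Theorems.FemtoTransferGap.TwoLattice.Stiff (LinkSpace)
open Summit.QuantumFields.YangMills.Theorems.FemtoTransferGap.TwoLattice.Cov (adRot_mul adRot_one sum_sq_adRot_mulVec)

variable (L : ℕ) [NeZero L]

/-! ## §1 The action on the flat coordinates and its Euclidean isometry -/

/-- `Ad_g` on the flat based coordinates (sitewise rotation). [folklore] -/
def adFlatL (g : SU2) : (NzSite L → Fin 3 → ℝ) →ₗ[ℝ] (NzSite L → Fin 3 → ℝ) where
  toFun w := fun y => (adRot g).mulVec (w y)
  map_add' a b := by funext y; simp only [Pi.add_apply, Matrix.mulVec_add]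
  map_smul' r a := by funext y; simp only [Pi.smul_apply, Matrix.mulVec_smul, RingHom.id_apply]

omit [NeZero L] in
/-- Components. [folklore] -/
@[simp] theorem adFlatL_apply (g : SU2) (w : NzSite L → Fin 3 → ℝ) (y : NzSite L) : adFlatL L g w y = (adRot g).mulVec (w y) := rfl

/-- `flatLin ∘ adFlat = adSiteL ∘ flatLin`. [folklore] -/
theorem flatLin_adFlat (g : SU2) (w : NzSite L → Fin 3 → ℝ) : flatLin L (adFlatL L g w) = adSiteL L g (flatLin L w) := by
  apply Subtype.ext; funext x
  rw [adSiteL_apply]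
  by_cases hx : x = 0
  · subst hx; rw [flatLin_apply_zero, flatLin_apply_zero, Matrix.mulVec_zero]
  · rw [flatLin_apply_of_ne L _ hx, flatLin_apply_of_ne L _ hx, adFlatL_apply]

/-- `Ad_g` on the Euclidean model of the flat coordinates, as a linear map. [folklore] -/
def adEuclLin (g : SU2) : EuclideanSpace ℝ (NzSite L × Fin 3) →ₗ[ℝ] EuclideanSpace ℝ (NzSite L × Fin 3) where
  toFun v := WithLp.toLp 2 fun ya : NzSite L × Fin 3 => ((adRot g).mulVec fun b => v (ya.1, b)) ya.2
  map_add' v w := by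
    ext ya
    simp only [WithLp.ofLp_add, Pi.add_apply]
    rw [show (fun b => v.ofLp (ya.1, b) + w.ofLp (ya.1, b)) = (fun b => v.ofLp (ya.1, b)) + fun b => w.ofLp (ya.1, b) from rfl,
      Matrix.mulVec_add, Pi.add_apply]
  map_smul' c v := by
    ext ya
    simp only [WithLp.ofLp_smul, Pi.smul_apply, smul_eq_mul, RingHom.id_apply]
    rw [show (fun b => c * v.ofLp (ya.1, b)) = c • fun b => v.ofLp (ya.1, b) from rfl, Matrix.mulVec_smul, Pi.smul_apply, smul_eq_mul]

omit [NeZero L] in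
/-- Components. [folklore] -/
theorem adEuclLin_apply (g : SU2) (v : EuclideanSpace ℝ (NzSite L × Fin 3)) (y : NzSite L) (a : Fin 3) :
    adEuclLin L g v (y, a) = ((adRot g).mulVec fun b => v (y, b)) a := rfl

omit [NeZero L] in
/-- It is multiplicative. [folklore] -/
theorem adEuclLin_mul_apply (g h : SU2) (v : EuclideanSpace ℝ (NzSite L × Fin 3)) : adEuclLin L (g * h) v = adEuclLin L g (adEuclLin L h v) := by
  ext ya
  rw [show ya = (ya.1, ya.2) from rfl, adEuclLin_apply, adEuclLin_apply, adRot_mul, ← Matrix.mulVec_mulVec]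
  rfl

omit [NeZero L] in
/-- `adEuclLin 1 = id`. [folklore] -/
theorem adEuclLin_one_apply (v : EuclideanSpace ℝ (NzSite L × Fin 3)) : adEuclLin L 1 v = v := by
  ext ya
  rw [show ya = (ya.1, ya.2) from rfl, adEuclLin_apply, adRot_one, Matrix.one_mulVec]

/-- It preserves the Euclidean norm. [folklore] -/
theorem norm_adEuclLin (g : SU2) (v : EuclideanSpace ℝ (NzSite L × Fin 3)) : ‖adEuclLin L g v‖ = ‖v‖ := by
  have e1 : ∑ x : NzSite L × Fin 3, (adEuclLin L g v x) ^ 2 = ∑ y : NzSite L, ∑ a : Fin 3, (adEuclLin L g v (y, a)) ^ 2 := Fintype.sum_prod_type _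
  have e2 : ∑ x : NzSite L × Fin 3, (v x) ^ 2 = ∑ y : NzSite L, ∑ a : Fin 3, (v (y, a)) ^ 2 := Fintype.sum_prod_type _
  have h : ‖adEuclLin L g v‖ ^ 2 = ‖v‖ ^ 2 := by
    simp only [EuclideanSpace.norm_sq_eq, Real.norm_eq_abs, sq_abs]
    rw [e1, e2]
    exact Finset.sum_congr rfl fun y _ => sum_sq_adRot_mulVec g (fun b => v (y, b))
  rw [← Real.sqrt_sq (norm_nonneg (adEuclLin L g v)), ← Real.sqrt_sq (norm_nonneg v), h]

/-- ★ `Ad_g` as a linear isometry equivalence of the Euclidean flat coordinates. [folklore] -/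
def adEucl (g : SU2) : EuclideanSpace ℝ (NzSite L × Fin 3) ≃ₗᵢ[ℝ] EuclideanSpace ℝ (NzSite L × Fin 3) where
  toLinearEquiv :=
    { adEuclLin L g with
      invFun := adEuclLin L g⁻¹
      left_inv := fun v => by
        show adEuclLin L g⁻¹ (adEuclLin L g v) = v
        rw [← adEuclLin_mul_apply, inv_mul_cancel, adEuclLin_one_apply]
      right_inv := fun v => by
        show adEuclLin L g (adEuclLin L g⁻¹ v) = v
        rw [← adEuclLin_mul_apply, mul_inv_cancel, adEuclLin_one_apply] }
  norm_map' := norm_adEuclLin L g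

/-- `euclToPiₗ ∘ adEucl = adFlat ∘ euclToPiₗ`. [folklore] -/
theorem euclToPi_adEucl (g : SU2) (v : EuclideanSpace ℝ (NzSite L × Fin 3)) : euclToPiₗ (NzSite L) (adEucl L g v) = adFlatL L g (euclToPiₗ (NzSite L) v) := by
  funext y a
  rfl

/-! ## §2 ★ Equivariance of the Laplace map and ★★ invariance of its Gaussian determinant -/

/-- ★ **`A_{Ad p} (adFlat w) = adL g (A_p w)`** for `p` near `0`. [folklore] -/
theorem laplaceMap_ad (g : SU2) : ∀ᶠ p : balancedSubmodule L × (Fin 3 → Fin 3 → ℝ) in 𝓝 0, ∀ w : NzSite L → Fin 3 → ℝ,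
    laplaceMap L (adParamL L g p) (adFlatL L g w) = adL L g (laplaceMap L p w) := by
  filter_upwards [basedLin_ad L g] with p hp w
  rw [laplaceMap_apply, laplaceMap_apply, flatLin_adFlat, hp, starProjection_adL]

/-- The restriction of the isometry `adL g` to a subspace has `normDet = 1`. [folklore] -/
theorem normDet_adL_domRestrict (g : SU2) (S : Submodule ℝ (LinkSpace L)) :
    (((adL L g).toLinearEquiv : LinkSpace L →ₗ[ℝ] LinkSpace L).domRestrict S).normDet = 1 := by
  have h : ((adL L g).toLinearEquiv : LinkSpace L →ₗ[ℝ] LinkSpace L).domRestrict S = ((adL L g).toLinearIsometry.comp S.subtypeₗᵢ).toLinearMap := by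
    refine LinearMap.ext fun x => ?_
    rfl
  rw [h]
  exact LinearIsometry.normDet_eq_one _

/-- ★★ **INVARIANCE OF THE GAUSSIAN DETERMINANT**: `normDet(A_{Ad_g p} ∘ e) = normDet(A_p ∘ e)` for `p` near `0`. [folklore] -/
theorem normDet_laplaceMap_ad (g : SU2) : ∀ᶠ p : balancedSubmodule L × (Fin 3 → Fin 3 → ℝ) in 𝓝 0,
    (laplaceMap L (adParamL L g p) ∘ₗ euclToPiₗ (NzSite L)).normDet = (laplaceMap L p ∘ₗ euclToPiₗ (NzSite L)).normDet := by
  filter_upwards [laplaceMap_ad L g] with p hp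
  -- the two compositions agree: `(A_{Ad p} ∘ e) ∘ adEucl = adL ∘ (A_p ∘ e)`
  have hcomp : (laplaceMap L (adParamL L g p) ∘ₗ euclToPiₗ (NzSite L)) ∘ₗ ((adEucl L g).toLinearEquiv : EuclideanSpace ℝ (NzSite L × Fin 3) →ₗ[ℝ] EuclideanSpace ℝ (NzSite L × Fin 3)) =
      ((adL L g).toLinearEquiv : LinkSpace L →ₗ[ℝ] LinkSpace L) ∘ₗ (laplaceMap L p ∘ₗ euclToPiₗ (NzSite L)) := by
    refine LinearMap.ext fun v => ?_
    show laplaceMap L (adParamL L g p) (euclToPiₗ (NzSite L) (adEucl L g v)) = adL L g (laplaceMap L p (euclToPiₗ (NzSite L) v))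
    rw [euclToPi_adEucl, hp]
  -- left side: precomposition with an isometry of the (equal-dimensional) domain
  have hleft : ((laplaceMap L (adParamL L g p) ∘ₗ euclToPiₗ (NzSite L)) ∘ₗ ((adEucl L g).toLinearEquiv : EuclideanSpace ℝ (NzSite L × Fin 3) →ₗ[ℝ] EuclideanSpace ℝ (NzSite L × Fin 3))).normDet =
      (laplaceMap L (adParamL L g p) ∘ₗ euclToPiₗ (NzSite L)).normDet := by
    rw [LinearMap.normDet_comp_of_finrank_eq _ _ rfl]
    have h1 : (((adEucl L g).toLinearEquiv : EuclideanSpace ℝ (NzSite L × Fin 3) →ₗ[ℝ] EuclideanSpace ℝ (NzSite L × Fin 3))).normDet = 1 :=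
      LinearIsometry.normDet_eq_one (adEucl L g).toLinearIsometry
    rw [h1, mul_one]
  -- right side: postcomposition with an isometry
  have hright : (((adL L g).toLinearEquiv : LinkSpace L →ₗ[ℝ] LinkSpace L) ∘ₗ (laplaceMap L p ∘ₗ euclToPiₗ (NzSite L))).normDet =
      (laplaceMap L p ∘ₗ euclToPiₗ (NzSite L)).normDet := by
    rw [LinearMap.normDet_comp, normDet_adL_domRestrict, one_mul]
  rw [← hleft, hcomp, hright]

end Summit.QuantumFields.YangMills.Theorems.FemtoTransferGap.TwoLattice.ConstTube

end
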